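import Summits.Ventures.HSemireg.WedgeHankelRecurrenceGaussRecurrenceUnique

/-!
# Venture HSemireg — **THE CONVERGENTS `r_n∕q_n` OF THE J-FRACTION ARE MONOTONE IN `n` OUTSIDE THE ZEROS**: by the Casoratian `q_n r_{n+1} − q_{n+1} r_n = b_1⋯b_n` (N281),
# `r_{n+1}(x)∕q_{n+1}(x) − r_n(x)∕q_n(x) = b_1⋯b_n ∕ (q_n(x) q_{n+1}(x))`, which is `> 0` to the right of the zeros of `q_{n+1}` (both monic members positive there) and `< 0` to the left of
# them (the members have the signs `(−1)^n`, `(−1)^{n+1}`)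

HONEST FRAMING. Part of the Lean index of the computation cell `pub-hsemireg` (seat p10 gen 44, Sunday typer «UNIFORM-IN-n»).  Real polynomials and finite products only; no variety, no cohomology
theory, no sheaf, no Ext group and no semiregularity map is constructed here; nothing here says that HC / HC_CM / HC_AV holds; no Literature fact (unproved `Prop`) is declared or used.  Custodian
versions as in `WedgeHankelSiegelIdeal` (1/3).
SOURCES (cited).  T. J. Stieltjes, *Recherches sur les fractions continues*, Ann. Fac. Sci. Toulouse 8 (1894) J1–J122, §§3–4 (monotonicity of the convergents on the positive axis); T. S. Chihara,
*An Introduction to Orthogonal Polynomials* (1978) Ch. III §4 (the associated polynomials and `P_n P^{(1)}_{n} − P_{n+1} P^{(1)}_{n−1} = λ_2⋯λ_{n+1}`); H. S. Wall, *Analytic Theory of Continued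
Fractions* (1948) Ch. XI.
PROOF TYPED HERE.  Evaluate N281 `recurrence_casoratian` at `x` and divide by `q_n(x) q_{n+1}(x) ≠ 0`; the sign of `∏_i (x − z_i)` to the right (all factors positive) and to the left (all negative,
`(−1)^{deg}`) of the zeros (N279), the top zero of `q_n` lying below that of `q_{n+1}` and the bottom zero above (interlacing).
DEDUP DISCLOSURE (`rg -n 'casoratian|convergent' Summits/Ventures/HSemireg`, 2026-09-03): N281 (Casoratian), N284 (`Σ λ_k∕(y − z_k) = r∕q`), N310 (resolvent), N314 (comparison with the
Stieltjes transform) are the tree's continued-fraction items; the monotonicity in `n` is new.  The 6 names below: 0 hits tree-wide.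

WHAT IS IN THE TREE.  N281 `recurrence_casoratian`; N279 `recurrence_zeros_interlace`.
THIS FILE (namespace `Summit.Ventures.HSemireg.Wedge.HankelOuter` continued; CHAINED on N336 (import only); 0 definitions):
* §1102 `convergent_sub_convergent_eq` (`r_{n+1}∕q_{n+1} − r_n∕q_n = b_1⋯b_n∕(q_n q_{n+1})` where both members are non-zero), `eval_prod_X_sub_C_pos_of_gt` (`∏(x − z_i) > 0` right of the
  zeros), `eval_prod_X_sub_C_sign_of_lt` (`(−1)^n ∏(x − z_i) > 0` left of the zeros), `recurrence_eval_signs_outside` (signs of `q_n`, `q_{n+1}` outside the zeros of `q_{n+1}`), **`convergents_strictMono_right`** (`r_n(x)∕q_n(x) < r_{n+1}(x)∕q_{n+1}(x)` for `x` right of the zeros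
  of `q_{n+1}`), **`convergents_strictAnti_left`** (`>` for `x` left of them).
CAVEATS.  Positive recurrences; `r` is the second-kind solution (`r_0 = 0`, `r_1 = 1`).  Nothing Ext-side.  New names only.
-/

open Module Polynomial
open scoped Matrix Polynomial

namespace Summit.Ventures.HSemireg.Wedge.HankelOuter

/-! ## §1102. Monotonicity of the J-fraction convergents outside the zeros -/

/-- **`r_{n+1}(x)∕q_{n+1}(x) − r_n(x)∕q_n(x) = b_1⋯b_n ∕ (q_n(x) q_{n+1}(x))`** where `q_n(x), q_{n+1}(x) ≠ 0` (Casoratian, N281). [Chihara III §4; this file, §1102] -/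
theorem convergent_sub_convergent_eq {q r : ℕ → ℝ[X]} {a b : ℕ → ℝ} (hq0 : q 0 = 1)
    (hrec : ∀ n, q (n + 2) = (Polynomial.X - C (a (n + 1))) * q (n + 1) - C (b (n + 1)) * q n) (hr0 : r 0 = 0) (hr1 : r 1 = 1)
    (hrrec : ∀ n, r (n + 2) = (Polynomial.X - C (a (n + 1))) * r (n + 1) - C (b (n + 1)) * r n) (n : ℕ) {x : ℝ}
    (hqn : (q n).eval x ≠ 0) (hqn1 : (q (n + 1)).eval x ≠ 0) :
    (r (n + 1)).eval x / (q (n + 1)).eval x - (r n).eval x / (q n).eval x = (∏ j ∈ Finset.Ico 1 (n + 1), b j) / ((q n).eval x * (q (n + 1)).eval x) := by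
  have h := congrArg (fun P : ℝ[X] => P.eval x) (recurrence_casoratian hq0 hrec hr0 hr1 hrrec n)
  simp only [eval_sub, eval_mul, eval_C] at h
  rw [div_sub_div _ _ hqn1 hqn, ← h]
  congr 1 <;> ring

/-- **Right of its zeros a monic product is positive: `z_i < x` for all `i` ⇒ `0 < ∏ (x − z_i)`.** [this file, §1102] -/
theorem eval_prod_X_sub_C_pos_of_gt {m : ℕ} {z : Fin m → ℝ} {x : ℝ} (hx : ∀ i, z i < x) : 0 < (∏ i, (Polynomial.X - C (z i))).eval x := by
  rw [eval_prod]
  exact Finset.prod_pos fun i _ => by rw [eval_sub, eval_X, eval_C]; exact sub_pos.2 (hx i)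

/-- **Left of its zeros: `x < z_i` for all `i` ⇒ `0 < (−1)^m ∏ (x − z_i)`.** [this file, §1102] -/
theorem eval_prod_X_sub_C_sign_of_lt {m : ℕ} {z : Fin m → ℝ} {x : ℝ} (hx : ∀ i, x < z i) : 0 < (-1 : ℝ) ^ m * (∏ i, (Polynomial.X - C (z i))).eval x := by
  rw [eval_prod, show ((-1 : ℝ)) ^ m = ∏ _i : Fin m, (-1 : ℝ) by rw [Finset.prod_const, Finset.card_univ, Fintype.card_fin], ← Finset.prod_mul_distrib]
  exact Finset.prod_pos fun i _ => by rw [eval_sub, eval_X, eval_C]; nlinarith [hx i]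

/-- **Signs of `q_n`, `q_{n+1}` outside the zeros of `q_{n+1}`** (positive recurrence): if `x` exceeds every zero of `q_{n+1}` then `q_n(x) > 0` and `q_{n+1}(x) > 0`; if `x` is below every zero
of `q_{n+1}` then `(−1)^n q_n(x) > 0` and `(−1)^{n+1} q_{n+1}(x) > 0` (the zeros of `q_n` interlace those of `q_{n+1}`, N279). [this file, §1102] -/
theorem recurrence_eval_signs_outside {q : ℕ → ℝ[X]} {a b : ℕ → ℝ} (hq0 : q 0 = 1) (hq1 : q 1 = Polynomial.X - C (a 0))
    (hrec : ∀ n, q (n + 2) = (Polynomial.X - C (a (n + 1))) * q (n + 1) - C (b (n + 1)) * q n) (hb : ∀ j, 0 < b j) (n : ℕ) (x : ℝ) :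
    ((∀ s, (q (n + 1)).eval s = 0 → s < x) → 0 < (q n).eval x ∧ 0 < (q (n + 1)).eval x) ∧
      ((∀ s, (q (n + 1)).eval s = 0 → x < s) → 0 < (-1 : ℝ) ^ n * (q n).eval x ∧ 0 < (-1 : ℝ) ^ (n + 1) * (q (n + 1)).eval x) := by
  have hroot : ∀ {m : ℕ} {z : Fin m → ℝ} {P : ℝ[X]}, P = ∏ i, (Polynomial.X - C (z i)) → ∀ i, P.eval (z i) = 0 := fun hP i => by
    rw [hP, eval_prod]; exact Finset.prod_eq_zero (Finset.mem_univ i) (by rw [eval_sub, eval_X, eval_C, sub_self])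
  rcases n with _ | m
  · obtain ⟨z, y, hz, hy, hzq, hyq, hint⟩ := recurrence_zeros_interlace hq0 hq1 hrec hb 0
    refine ⟨fun hx => ⟨by rw [hq0, eval_one]; exact one_pos, ?_⟩, fun hx => ⟨by rw [hq0, eval_one, pow_zero, one_mul]; exact one_pos, ?_⟩⟩
    · rw [hzq]; exact eval_prod_X_sub_C_pos_of_gt fun k => hx _ (hroot hzq k)
    · rw [hzq]; exact eval_prod_X_sub_C_sign_of_lt fun k => hx _ (hroot hzq k)
  · obtain ⟨z, y, hz, hy, hzq, hyq, hint⟩ := recurrence_zeros_interlace hq0 hq1 hrec hb m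
    refine ⟨fun hx => ⟨?_, ?_⟩, fun hx => ⟨?_, ?_⟩⟩
    · rw [hzq]; exact eval_prod_X_sub_C_pos_of_gt fun k => (hint k).2.trans (hx _ (hroot hyq k.succ))
    · rw [hyq]; exact eval_prod_X_sub_C_pos_of_gt fun k => hx _ (hroot hyq k)
    · rw [hzq]; exact eval_prod_X_sub_C_sign_of_lt fun k => (hx _ (hroot hyq k.castSucc)).trans (hint k).1
    · rw [hyq]; exact eval_prod_X_sub_C_sign_of_lt fun k => hx _ (hroot hyq k)

/-- **THE CONVERGENTS INCREASE WITH `n` TO THE RIGHT OF THE ZEROS: if `x` exceeds every zero of `q_{n+1}` then `r_n(x)∕q_n(x) < r_{n+1}(x)∕q_{n+1}(x)`.** [Stieltjes 1894 §3; Wall Ch. XI;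
this file, §1102] -/
theorem convergents_strictMono_right {q r : ℕ → ℝ[X]} {a b : ℕ → ℝ} (hq0 : q 0 = 1) (hq1 : q 1 = Polynomial.X - C (a 0))
    (hrec : ∀ n, q (n + 2) = (Polynomial.X - C (a (n + 1))) * q (n + 1) - C (b (n + 1)) * q n) (hr0 : r 0 = 0) (hr1 : r 1 = 1)
    (hrrec : ∀ n, r (n + 2) = (Polynomial.X - C (a (n + 1))) * r (n + 1) - C (b (n + 1)) * r n) (hb : ∀ j, 0 < b j)
    (n : ℕ) {x : ℝ} (hx : ∀ s, (q (n + 1)).eval s = 0 → s < x) :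
    (r n).eval x / (q n).eval x < (r (n + 1)).eval x / (q (n + 1)).eval x := by
  obtain ⟨hn, hn1⟩ := (recurrence_eval_signs_outside hq0 hq1 hrec hb n x).1 hx
  rw [← sub_pos, convergent_sub_convergent_eq hq0 hrec hr0 hr1 hrrec n hn.ne' hn1.ne']
  exact div_pos (Finset.prod_pos fun j _ => hb j) (mul_pos hn hn1)

/-- **THE CONVERGENTS DECREASE WITH `n` TO THE LEFT OF THE ZEROS: if `x` is below every zero of `q_{n+1}` then `r_{n+1}(x)∕q_{n+1}(x) < r_n(x)∕q_n(x)`.** [Stieltjes 1894; Wall Ch. XI; this file,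
§1102] -/
theorem convergents_strictAnti_left {q r : ℕ → ℝ[X]} {a b : ℕ → ℝ} (hq0 : q 0 = 1) (hq1 : q 1 = Polynomial.X - C (a 0))
    (hrec : ∀ n, q (n + 2) = (Polynomial.X - C (a (n + 1))) * q (n + 1) - C (b (n + 1)) * q n) (hr0 : r 0 = 0) (hr1 : r 1 = 1)
    (hrrec : ∀ n, r (n + 2) = (Polynomial.X - C (a (n + 1))) * r (n + 1) - C (b (n + 1)) * r n) (hb : ∀ j, 0 < b j)
    (n : ℕ) {x : ℝ} (hx : ∀ s, (q (n + 1)).eval s = 0 → x < s) :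
    (r (n + 1)).eval x / (q (n + 1)).eval x < (r n).eval x / (q n).eval x := by
  obtain ⟨hn, hn1⟩ := (recurrence_eval_signs_outside hq0 hq1 hrec hb n x).2 hx
  have hprod : (q n).eval x * (q (n + 1)).eval x < 0 := by
    have h : 0 < ((-1 : ℝ) ^ n * (q n).eval x) * ((-1 : ℝ) ^ (n + 1) * (q (n + 1)).eval x) := mul_pos hn hn1
    have hsq : ((-1 : ℝ) ^ n) ^ 2 = 1 := by rw [← pow_mul, mul_comm, pow_mul, neg_one_sq, one_pow]
    have e : ((-1 : ℝ) ^ n * (q n).eval x) * ((-1 : ℝ) ^ (n + 1) * (q (n + 1)).eval x) = -((q n).eval x * (q (n + 1)).eval x) * ((-1 : ℝ) ^ n) ^ 2 := by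
      rw [pow_succ]; ring
    rw [e, hsq, mul_one] at h
    linarith
  have hn0 : (q n).eval x ≠ 0 := fun h => by rw [h, zero_mul] at hprod; exact lt_irrefl 0 hprod
  have hn10 : (q (n + 1)).eval x ≠ 0 := fun h => by rw [h, mul_zero] at hprod; exact lt_irrefl 0 hprod
  rw [← sub_neg, convergent_sub_convergent_eq hq0 hrec hr0 hr1 hrrec n hn0 hn10]
  exact div_neg_of_pos_of_neg (Finset.prod_pos fun j _ => hb j) hprod

end Summit.Ventures.HSemireg.Wedge.HankelOuter
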